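import Literature.Combinatorics.Optimization.CoverMonoidVeronese
import Literature.AlgebraicGeometry.Resolution.MonomialIdealsRegularParameters
import HarnessLib

/-!
# Symbolic powers of squarefree monomial ideals in (part of) a regular system of parameters are Veronese-standard (Herzog–Hibi–Trung 2007, Cor. 2.2)

Topic: `Literature/AlgebraicGeometry/Resolution`. Let `S` be a commutative ring and `u : Fin N → S` a
family satisfying hypothesis (H) of `MonomialIdealsRegularParameters.lean` — `u_i` is a non-zero-divisor
modulo `(u_t : t ∈ T)` whenever `i ∉ T`; e.g. a regular system of parameters of a regular local ring
(`mem_span_image_of_mul_mem_rsop`, Matsumura 14.2/14.3/17.8) or the variables of a polynomial ring. For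
a finite family `𝒮` of subsets of `Fin N` put `𝔭_T = (u_i : i ∈ T)` and consider the «monomial symbolic
powers» `⋂_{T ∈ 𝒮} 𝔭_T^n` of the reduced monomial ideal `⋂_{T ∈ 𝒮} 𝔭_T`.

* `uPow_mem_pow_span_image` — `u^c ∈ 𝔭_T^{|c|_T}` (`|c|_T = ∑_{i∈T} c_i`);
  `pow_span_image_le_span_uPow` — `𝔭_T^n ⊆ (u^c : |c|_T ≥ n)`;
* **`iInf_pow_span_image_eq_span_uPow`** — under (H):
  `⋂_{T ∈ 𝒮} 𝔭_T^n = (u^c : |c|_T ≥ n for all T ∈ 𝒮)` is the monomial ideal on the exponent set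
  `E_n(𝒮)` of `Combinatorics/Optimization/CoverMonoidVeronese.lean` (`CoverMonoid.Covers 𝒮 n`);
* **`iInf_pow_span_image_veronese`** — under (H), for a standard Veronese level `b₀` of the cover monoid
  of `𝒮` (which exists, `CoverMonoid.exists_veronese_level`, and depends only on `(N, 𝒮)`, not on the ring):
  `⋂_T 𝔭_T^{k b₀} ⊆ (⋂_T 𝔭_T^{b₀})^k` for every `k` — [HerzogHibiTrung2007, Cor. 2.2] «there exists an
  integer `d` such that `(⋂_j I_j^d)^k = ⋂_j I_j^{dk}` for all `k ≥ 1`» for the monomial primes `I_j = 𝔭_{T_j}`,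
  transported from the polynomial ring to any family with (H) by the monomial-ideal calculus of
  Cossart–Piltant 2019 Prop. 2.1 (`span_uPow_inf_span_uPow`, tree); `exists_iInf_pow_span_image_veronese`;
* `iInf_pow_span_image_veronese_rsop` / `exists_iInf_pow_span_image_veronese_rsop` — the case of a regular
  system of parameters `x` of a regular local ring (format `(hd, x, hx)` of `SymbolicPowersRsop.lean`).

This is the ring-level half of the HIRONAKA campaign's W3.6 supply lemma «T-B» (`VeroneseOfMonomialCut`):
at a point where a closed set is a reduced union of coordinate subspaces of a regular system of parameters,
its differential powers are these `⋂_T 𝔭_T^n` (`Hironaka2017/Lib/DiffPowerMonomialCut.lean`). Everything is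
PROVED; no definitions. Seat res-L1-s36-pv-1 (res-hironaka, rung L, slot W3.6).

## Sources
* J. Herzog, T. Hibi, N. V. Trung, Adv. Math. 210 (2007) 304–322, Thm. 2.1, Cor. 2.2. [HerzogHibiTrung2007]
* V. Cossart, O. Piltant, J. Algebra 529 (2019), Prop. 2.1 (monomial ideals in a r.s.p.). [CossartPiltant2019]
* H. Matsumura, *Commutative Ring Theory* (1986), Thms. 14.2, 14.3, 17.8. [Matsumura1987]
-/

namespace Literature.AlgebraicGeometry.Resolution

open CossartPiltant Literature.Combinatorics.Optimization.CoverMonoid Finset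

universe u

section General

variable {S : Type u} [CommRing S] {N : ℕ} (u : Fin N → S)

/-- **`u^c ∈ 𝔭_T^{|c|_T}`**: a monomial lies in the power of `𝔭_T = (u_i : i ∈ T)` given by its `T`-degree.
[cite: HerzogHibiTrung2007, §3 (symbolic powers of monomial ideals), Thm. 2.1] -/
theorem uPow_mem_pow_span_image (T : Finset (Fin N)) (c : Fin N → ℕ) :
    uPow u c ∈ Ideal.span (u '' ↑T) ^ (∑ i ∈ T, c i) := by
  classical
  have hsplit : uPow u c = (∏ i ∈ T, u i ^ c i) * ∏ i ∈ Tᶜ, u i ^ c i := by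
    rw [uPow, ← Finset.prod_mul_prod_compl T]
  rw [hsplit]
  refine Ideal.mul_mem_right _ _ ?_
  rw [← Finset.prod_pow_eq_pow_sum T c (Ideal.span (u '' ↑T))]
  refine Ideal.prod_mem_prod fun i hi => Ideal.pow_mem_pow ?_ (c i)
  exact Ideal.subset_span (show u i ∈ u '' ↑T from ⟨i, Finset.mem_coe.mpr hi, rfl⟩)

/-- A monomial whose `T`-degree is `≥ n` for every `T ∈ 𝒮` lies in `⋂_{T ∈ 𝒮} 𝔭_T^n`.
[cite: HerzogHibiTrung2007, §3, Thm. 2.1] -/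
theorem uPow_mem_iInf_pow_span_image {𝒮 : Finset (Finset (Fin N))} {n : ℕ} {c : Fin N → ℕ}
    (hc : Covers 𝒮 n c) : uPow u c ∈ ⨅ T ∈ 𝒮, Ideal.span (u '' ↑T) ^ n := by
  simp only [Ideal.mem_iInf]
  intro T hT
  exact Ideal.pow_le_pow_right (hc T hT) (uPow_mem_pow_span_image u T c)

/-- **`(u^c : c ∈ E_n(𝒮)) ⊆ ⋂_{T ∈ 𝒮} 𝔭_T^n`** (no hypothesis on `u`). [cite: HerzogHibiTrung2007, §3, Thm. 2.1] -/
theorem span_uPow_covers_le_iInf (𝒮 : Finset (Finset (Fin N))) (n : ℕ) :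
    Ideal.span (uPow u '' {c | Covers 𝒮 n c}) ≤ ⨅ T ∈ 𝒮, Ideal.span (u '' ↑T) ^ n := by
  rw [span_uPow_le_iff]
  exact fun c hc => uPow_mem_iInf_pow_span_image u hc

/-- Products of monomial ideals: `(u^a : a ∈ A) · (u^b : b ∈ B) = (u^{a+b} : a ∈ A, b ∈ B)` (monomial bookkeeping as in
Cossart–Piltant's Ch. 2). [cite: CossartPiltant2019, Ch. 2 (arXiv v1 p. 9, monomial ideals `(u^a)`)] -/
theorem span_uPow_mul_span_uPow (A B : Set (Fin N → ℕ)) :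
    Ideal.span (uPow u '' A) * Ideal.span (uPow u '' B) = Ideal.span (uPow u '' Set.image2 (· + ·) A B) := by
  rw [Ideal.span_mul_span']
  congr 1
  ext f
  simp only [Set.mem_mul, Set.mem_image, Set.mem_image2]
  constructor
  · rintro ⟨_, ⟨a, ha, rfl⟩, _, ⟨b, hb, rfl⟩, rfl⟩
    exact ⟨a + b, ⟨a, ha, b, hb, rfl⟩, uPow_add u a b⟩
  · rintro ⟨_, ⟨a, ha, b, hb, rfl⟩, rfl⟩
    exact ⟨uPow u a, ⟨a, ha, rfl⟩, uPow u b, ⟨b, hb, rfl⟩, (uPow_add u a b).symm⟩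

/-- `(u^c : |c|_T ≥ m) · (u^c : |c|_T ≥ n) ⊆ (u^c : |c|_T ≥ m + n)` (graded family of the `T`-degree).
[cite: CossartPiltant2019, Ch. 2 (arXiv v1 p. 9, monomial ideals `(u^a)`)] [cite: HerzogHibiTrung2007, Thm. 2.1] -/
theorem span_uPow_tdeg_mul_le (T : Finset (Fin N)) (m n : ℕ) :
    Ideal.span (uPow u '' {c | m ≤ ∑ i ∈ T, c i}) * Ideal.span (uPow u '' {c | n ≤ ∑ i ∈ T, c i}) ≤
      Ideal.span (uPow u '' {c | m + n ≤ ∑ i ∈ T, c i}) := by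
  rw [span_uPow_mul_span_uPow]
  refine Ideal.span_mono (Set.image_mono ?_)
  rintro _ ⟨a, ha, b, hb, rfl⟩
  simp only [Set.mem_setOf_eq, Pi.add_apply, Finset.sum_add_distrib] at ha hb ⊢
  exact Nat.add_le_add ha hb

/-- **`𝔭_T^n ⊆ (u^c : |c|_T ≥ n)`** (no hypothesis on `u`): the generators `u_i = u^{e_i}`, `i ∈ T`, have
`T`-degree `1`. [cite: HerzogHibiTrung2007, §3, Thm. 2.1] -/
theorem pow_span_image_le_span_uPow (T : Finset (Fin N)) :
    ∀ n : ℕ, Ideal.span (u '' ↑T) ^ n ≤ Ideal.span (uPow u '' {c | n ≤ ∑ i ∈ T, c i}) := by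
  classical
  have h1 : Ideal.span (u '' ↑T) ≤ Ideal.span (uPow u '' {c | 1 ≤ ∑ i ∈ T, c i}) := by
    rw [Ideal.span_le]
    rintro _ ⟨i, hi, rfl⟩
    rw [← uPow_single u i]
    refine uPow_mem_span_uPow u ?_
    change 1 ≤ ∑ j ∈ T, (Pi.single i 1 : Fin N → ℕ) j
    rw [Finset.sum_pi_single']
    simp [Finset.mem_coe.mp hi]
  intro n
  induction n with
  | zero =>
    rw [pow_zero, Ideal.one_eq_top, top_le_iff, Ideal.eq_top_iff_one, ← uPow_zero u]
    exact uPow_mem_span_uPow u (by simp)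
  | succ n ih =>
    rw [pow_succ]
    exact (Ideal.mul_mono ih h1).trans (span_uPow_tdeg_mul_le u T n 1)

variable (H : ∀ (i : Fin N) (T : Finset (Fin N)), i ∉ T →
  ∀ y, u i * y ∈ Ideal.span (u '' ↑T) → y ∈ Ideal.span (u '' ↑T))
include H

/-- **`⋂_{T ∈ 𝒮} 𝔭_T^n ⊆ (u^c : c ∈ E_n(𝒮))`** under (H): finite intersections of monomial ideals are the
monomial ideals of the joins of exponents (Cossart–Piltant 2019 Prop. 2.1 calculus,
`mem_span_uPow_setOf_forall_exists_le`). [cite: CossartPiltant2019, Prop. 2.1 (arXiv v1 p. 10)] -/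
theorem iInf_pow_span_image_le_span_uPow (𝒮 : Finset (Finset (Fin N))) (n : ℕ) :
    (⨅ T ∈ 𝒮, Ideal.span (u '' ↑T) ^ n) ≤ Ideal.span (uPow u '' {c | Covers 𝒮 n c}) := by
  intro f hf
  simp only [Ideal.mem_iInf] at hf
  have hf' : ∀ T ∈ 𝒮, f ∈ Ideal.span (uPow u '' {c | n ≤ ∑ i ∈ T, c i}) := fun T hT =>
    pow_span_image_le_span_uPow u T n (hf T hT)
  refine span_uPow_mono_of_forall_exists_le u (fun c hc => ?_)
    (mem_span_uPow_setOf_forall_exists_le u H 𝒮 (fun T => {c | n ≤ ∑ i ∈ T, c i}) hf')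
  refine ⟨c, fun T hT => ?_, le_rfl⟩
  obtain ⟨b, hb, hbc⟩ := hc T hT
  exact le_trans hb (Finset.sum_le_sum fun i _ => hbc i)

/-- **Monomial symbolic powers are monomial ideals**: under (H),
`⋂_{T ∈ 𝒮} 𝔭_T^n = (u^c : |c|_T ≥ n for all T ∈ 𝒮)`. [cite: HerzogHibiTrung2007, §3 and Thm. 2.1] -/
theorem iInf_pow_span_image_eq_span_uPow (𝒮 : Finset (Finset (Fin N))) (n : ℕ) :
    (⨅ T ∈ 𝒮, Ideal.span (u '' ↑T) ^ n) = Ideal.span (uPow u '' {c | Covers 𝒮 n c}) :=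
  le_antisymm (iInf_pow_span_image_le_span_uPow u H 𝒮 n) (span_uPow_covers_le_iInf u 𝒮 n)

omit H in
/-- **Veronese for the monomial ideals `(u^c : c ∈ E_n(𝒮))`** at a standard Veronese level `b₀` of the cover
monoid (no hypothesis on `u`): `(u^c : c ∈ E_{k b₀}) ⊆ (u^c : c ∈ E_{b₀})^k`, since `c ≥ c_1 + ⋯ + c_k` with
`c_j ∈ E_{b₀}` gives `u^c ∈ u^{c_1} ⋯ u^{c_k} S`. [cite: HerzogHibiTrung2007, Thm. 2.1, Cor. 2.2] -/
theorem span_uPow_covers_veronese {𝒮 : Finset (Finset (Fin N))} {b₀ : ℕ}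
    (hlev : ∀ (k : ℕ) (c : Fin N → ℕ), Covers 𝒮 (k * b₀) c →
      ∃ cs : Fin k → Fin N → ℕ, (∀ j, Covers 𝒮 b₀ (cs j)) ∧ ∑ j, cs j ≤ c)
    (k : ℕ) :
    Ideal.span (uPow u '' {c | Covers 𝒮 (k * b₀) c}) ≤ Ideal.span (uPow u '' {c | Covers 𝒮 b₀ c}) ^ k := by
  rw [span_uPow_le_iff]
  intro c hc
  obtain ⟨cs, hcs, hsum⟩ := hlev k c hc
  obtain ⟨r, hr⟩ := uPow_dvd_uPow_of_le u hsum
  rw [hr]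
  refine Ideal.mul_mem_right _ _ ?_
  have hprod : uPow u (∑ j, cs j) = ∏ j, uPow u (cs j) := by
    induction (Finset.univ : Finset (Fin k)) using Finset.induction_on with
    | empty => simp
    | insert a s ha ih => rw [Finset.sum_insert ha, Finset.prod_insert ha, uPow_add, ih]
  rw [hprod, show Ideal.span (uPow u '' {c | Covers 𝒮 b₀ c}) ^ k =
      ∏ _j : Fin k, Ideal.span (uPow u '' {c | Covers 𝒮 b₀ c}) by
    rw [Finset.prod_const, Finset.card_univ, Fintype.card_fin]]
  exact Ideal.prod_mem_prod fun j _ => uPow_mem_span_uPow u (hcs j)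

/-- **Herzog–Hibi–Trung 2007, Cor. 2.2, for a family with (H)**: at a standard Veronese level `b₀` of the
cover monoid of `𝒮`, `⋂_{T ∈ 𝒮} 𝔭_T^{k b₀} ⊆ (⋂_{T ∈ 𝒮} 𝔭_T^{b₀})^k` for every `k` (the reverse inclusion
is automatic). The level `b₀` depends only on `(N, 𝒮)`. [cite: HerzogHibiTrung2007, Cor. 2.2] -/
theorem iInf_pow_span_image_veronese {𝒮 : Finset (Finset (Fin N))} {b₀ : ℕ}
    (hlev : ∀ (k : ℕ) (c : Fin N → ℕ), Covers 𝒮 (k * b₀) c →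
      ∃ cs : Fin k → Fin N → ℕ, (∀ j, Covers 𝒮 b₀ (cs j)) ∧ ∑ j, cs j ≤ c)
    (k : ℕ) :
    (⨅ T ∈ 𝒮, Ideal.span (u '' ↑T) ^ (k * b₀)) ≤ (⨅ T ∈ 𝒮, Ideal.span (u '' ↑T) ^ b₀) ^ k :=
  (iInf_pow_span_image_le_span_uPow u H 𝒮 (k * b₀)).trans
    ((span_uPow_covers_veronese u hlev k).trans (Ideal.pow_right_mono (span_uPow_covers_le_iInf u 𝒮 b₀) k))

/-- **Herzog–Hibi–Trung 2007, Cor. 2.2 (existence form) for a family with (H)**: there is `b₀ > 0` with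
`⋂_T 𝔭_T^{k b₀} ⊆ (⋂_T 𝔭_T^{b₀})^k` for all `k`. [cite: HerzogHibiTrung2007, Cor. 2.2] -/
theorem exists_iInf_pow_span_image_veronese (𝒮 : Finset (Finset (Fin N))) :
    ∃ b₀ : ℕ, 0 < b₀ ∧ ∀ k : ℕ,
      (⨅ T ∈ 𝒮, Ideal.span (u '' ↑T) ^ (k * b₀)) ≤ (⨅ T ∈ 𝒮, Ideal.span (u '' ↑T) ^ b₀) ^ k := by
  obtain ⟨b₀, hb₀, hlev⟩ := exists_veronese_level 𝒮
  exact ⟨b₀, hb₀, fun k => iInf_pow_span_image_veronese u H hlev k⟩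

end General

/-! ## Regular systems of parameters -/

section Rsop

open IsLocalRing

variable {R : Type u} [CommRing R] [IsRegularLocalRing R] {d : ℕ}
  (hd : (maximalIdeal R).spanFinrank = d) (x : Fin d → R) (hx : Ideal.span (Set.range x) = maximalIdeal R)

include hd hx

/-- **Monomial symbolic powers in a regular system of parameters are monomial ideals**:
`⋂_{T ∈ 𝒮} (x_i : i ∈ T)^n = (x^c : |c|_T ≥ n ∀ T ∈ 𝒮)`. [cite: HerzogHibiTrung2007, §3; Matsumura1987, Thm. 17.8] -/
theorem iInf_pow_span_image_eq_span_uPow_rsop (𝒮 : Finset (Finset (Fin d))) (n : ℕ) :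
    (⨅ T ∈ 𝒮, Ideal.span (x '' ↑T) ^ n) = Ideal.span (uPow x '' {c | Covers 𝒮 n c}) :=
  iInf_pow_span_image_eq_span_uPow x (mem_span_image_of_mul_mem_rsop hd x hx) 𝒮 n

/-- **Herzog–Hibi–Trung 2007, Cor. 2.2, in a regular system of parameters** `x` of a regular local ring: at a
standard Veronese level `b₀` of the cover monoid of `𝒮` (depending only on `(d, 𝒮)`),
`⋂_{T ∈ 𝒮} (x_i : i ∈ T)^{k b₀} ⊆ (⋂_{T ∈ 𝒮} (x_i : i ∈ T)^{b₀})^k` for every `k`.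
[cite: HerzogHibiTrung2007, Cor. 2.2] [cite: Matsumura1987, Thm. 17.8] -/
theorem iInf_pow_span_image_veronese_rsop {𝒮 : Finset (Finset (Fin d))} {b₀ : ℕ}
    (hlev : ∀ (k : ℕ) (c : Fin d → ℕ), Covers 𝒮 (k * b₀) c →
      ∃ cs : Fin k → Fin d → ℕ, (∀ j, Covers 𝒮 b₀ (cs j)) ∧ ∑ j, cs j ≤ c)
    (k : ℕ) :
    (⨅ T ∈ 𝒮, Ideal.span (x '' ↑T) ^ (k * b₀)) ≤ (⨅ T ∈ 𝒮, Ideal.span (x '' ↑T) ^ b₀) ^ k :=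
  iInf_pow_span_image_veronese x (mem_span_image_of_mul_mem_rsop hd x hx) hlev k

/-- Existence form in a regular system of parameters. [cite: HerzogHibiTrung2007, Cor. 2.2] -/
theorem exists_iInf_pow_span_image_veronese_rsop (𝒮 : Finset (Finset (Fin d))) :
    ∃ b₀ : ℕ, 0 < b₀ ∧ ∀ k : ℕ,
      (⨅ T ∈ 𝒮, Ideal.span (x '' ↑T) ^ (k * b₀)) ≤ (⨅ T ∈ 𝒮, Ideal.span (x '' ↑T) ^ b₀) ^ k :=
  exists_iInf_pow_span_image_veronese x (mem_span_image_of_mul_mem_rsop hd x hx) 𝒮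

end Rsop

end Literature.AlgebraicGeometry.Resolution
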